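import Summits.NavierStokesRegularity.NavierStokesRegularity.Theorems.ScaledTopAlignmentBulkRung
import HarnessLib

/-!
# Route `ScaledTopAlignment`: BC5 / T3 rungs of the WINDOW-BULK door W3ʷᵇ = `AprioriWindowBulkAlignment`
# (stmt-NavierStokesRegularity-19447, the route's load-bearing crux since rev 9–10, 2026-08-26), BY NAME

Planner p3 g3 (tenure revs 8–10): `closes (hW : AprioriWindowBulkAlignment) (hZ : TypeIParabolicZoomLimit)
(hII : NoTypeII) : NavierStokesRegularity`.  This file supplies the dominated-side rungs of the NEW deciding crux, by
name against the route decls, through p5's landed rungs of W3′ (`ScaledTopAlignmentBulkRung`):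
* `aprioriWindowBulkAlignment_of_aprioriScaledBulkAlignment` — W3′ ⇒ W3ʷᵇ (λ₀ = ½, R₀ = 1; the rate window is dropped);
* `aprioriWindowBulkAlignment_of_aprioriScaledTopAlignment` — W3 ⇒ W3ʷᵇ;
* `aprioriWindowBulkAlignment_of_aprioriContinuousAlignment` — W1 (route ContinuousAlignment, stmt-18585) ⇒ W3ʷᵇ;
* `windowBulkAlignedAt_of_continuousAlignmentAt` — (CA) at ONE solution (fixed modulus on a level set, CF93 / GM11 Thm 1.1
  hypothesis) ⇒ W3ʷᵇ's conclusion at that solution (the T3 witness for 19447: a regime — general-modulus (CA) without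
  Type I — where regularity is open in print, cf. the docstring of `scaledBulkAlignedAt_of_continuousAlignmentAt`).
WHAT THIS IS NOT: not NS regularity, no progress on W3ʷᵇ itself — implications between OPEN a-priori statements and one
hypothesis-side rung. [cite: GigaMiura2011, Thm 1.1 with condition (CA) (§1; HUPS preprint #956 p. 3)]
-/

noncomputable section
set_option linter.dupNamespace false
open MeasureTheory Set Filter Topology Literature.Analysis.FluidPDE

namespace Summit.NavierStokesRegularity.NavierStokesRegularity.Theorems

/-- **W3′ ⇒ W3ʷᵇ, BY NAME** (λ₀ = ½, R₀ = 1; the rate predicate `κ/(T−t) ≤ |ω|` is not used). [folklore] -/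
theorem aprioriWindowBulkAlignment_of_aprioriScaledBulkAlignment
    (hW : Summit.NavierStokesRegularity.NavierStokesRegularity.Theses.ScaledTopAlignment.AprioriScaledBulkAlignment) :
    Summit.NavierStokesRegularity.NavierStokesRegularity.Theses.ScaledTopAlignment.AprioriWindowBulkAlignment := by
  intro ν T hν hT u p hcl hLH hdec
  refine ⟨1 / 2, by norm_num, 1, one_pos, ?_⟩
  intro κ _hκ ε hε δ hδ
  obtain ⟨M, hM, hb⟩ := hW ν T hν hT u p hcl hLH hdec (1 / 2) (by norm_num) (by norm_num) 1 one_pos ε hε δ hδ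
  exact ⟨M, hM, fun t ht x hx _hrate => by simpa using hb t ht x hx⟩

/-- **W3 ⇒ W3ʷᵇ, BY NAME** (through W3 ⇒ W3′, `aprioriScaledBulkAlignment_of_aprioriScaledTopAlignment`). [folklore] -/
theorem aprioriWindowBulkAlignment_of_aprioriScaledTopAlignment
    (hW3 : Summit.NavierStokesRegularity.NavierStokesRegularity.Theses.ScaledTopAlignment.AprioriScaledTopAlignment) :
    Summit.NavierStokesRegularity.NavierStokesRegularity.Theses.ScaledTopAlignment.AprioriWindowBulkAlignment :=
  aprioriWindowBulkAlignment_of_aprioriScaledBulkAlignment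
    (aprioriScaledBulkAlignment_of_aprioriScaledTopAlignment hW3)

/-- **W1 ⇒ W3ʷᵇ, BY NAME** (the residual crux of route ContinuousAlignment, stmt-NavierStokesRegularity-18585,
implies the window-bulk door; through W1 ⇒ W3′). [folklore] -/
theorem aprioriWindowBulkAlignment_of_aprioriContinuousAlignment
    (hW1 : Summit.NavierStokesRegularity.NavierStokesRegularity.Theses.ContinuousAlignment.AprioriContinuousAlignment) :
    Summit.NavierStokesRegularity.NavierStokesRegularity.Theses.ScaledTopAlignment.AprioriWindowBulkAlignment :=
  aprioriWindowBulkAlignment_of_aprioriScaledBulkAlignment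
    (aprioriScaledBulkAlignment_of_aprioriContinuousAlignment hW1)

/-- **BC5 rung of W3ʷᵇ: (CA) at a solution implies W3ʷᵇ's conclusion at that solution** (λ₀ = ½, R₀ = 1, any
κ; through `scaledBulkAlignedAt_of_continuousAlignmentAt`). The regime — a general-modulus continuous-alignment
hypothesis WITHOUT a Type-I assumption — is one where regularity is open in print (CF93 needs a Lipschitz-type
modulus, Beirão da Veiga–Berselli a Hölder-½ one, GM11 Thm 1.1 excludes only Type-I blow-up).
[cite: GigaMiura2011, Thm 1.1 with condition (CA) (§1; HUPS preprint #956 p. 3)] -/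
theorem windowBulkAlignedAt_of_continuousAlignmentAt {ν T : ℝ} (hν : 0 < ν)
    {u : ℝ → EuclideanSpace ℝ (Fin 3) → EuclideanSpace ℝ (Fin 3)}
    (hCA : ∃ d : ℝ, 0 < d ∧ ∃ η : ℝ → ℝ, Tendsto η (𝓝[>] 0) (𝓝 0) ∧
      ∀ t ∈ Ico 0 T, ∀ x y : EuclideanSpace ℝ (Fin 3), d < ‖curl (u t) x‖ → d < ‖curl (u t) y‖ →
        x ≠ y → ‖(‖curl (u t) x‖⁻¹ • curl (u t) x) - (‖curl (u t) y‖⁻¹ • curl (u t) y)‖ ≤ η ‖x - y‖) :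
    ∃ lam0 : ℝ, lam0 < 1 ∧ ∃ R0 : ℝ, 0 < R0 ∧
      ∀ κ : ℝ, 0 < κ → ∀ ε : ℝ, 0 < ε → ∀ δ : ℝ, 0 < δ → ∃ M : ℝ, 0 < M ∧
        ∀ t ∈ Set.Ico 0 T, ∀ x : EuclideanSpace ℝ (Fin 3), M ≤ ‖curl (u t) x‖ → κ / (T - t) ≤ ‖curl (u t) x‖ →
          volume {y : EuclideanSpace ℝ (Fin 3) | lam0 * ‖curl (u t) x‖ ≤ ‖curl (u t) y‖ ∧
              ‖x - y‖ ≤ R0 * Real.sqrt (ν / ‖curl (u t) x‖) ∧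
              ε < Real.sqrt (1 - (inner ℝ (‖curl (u t) x‖⁻¹ • curl (u t) x)
                (‖curl (u t) y‖⁻¹ • curl (u t) y)) ^ 2)}
            ≤ ENNReal.ofReal (δ * Real.sqrt (ν / ‖curl (u t) x‖) ^ 3) := by
  refine ⟨1 / 2, by norm_num, 1, one_pos, ?_⟩
  intro κ _hκ ε hε δ hδ
  obtain ⟨M, hM, hb⟩ := scaledBulkAlignedAt_of_continuousAlignmentAt (T := T) hν hCA (1 / 2) (by norm_num) (by norm_num)
    1 one_pos ε hε δ hδ
  exact ⟨M, hM, fun t ht x hx _hrate => by simpa using hb t ht x hx⟩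

end Summit.NavierStokesRegularity.NavierStokesRegularity.Theorems

end
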